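import Mathlib
import HarnessLib

/-!
# Route `IntegerScrew` — Abel summation over a RANGE with two-sided partial sums
# (CONTINUUM-LIMIT §25.10 (b): the tool for the tilt `τ(b) = Σ_{p ≤ q ≤ R/b} (log q/(q log(bq)))·Γ(bq)`)

`IntegerScrewChebyshevAbel` sums `Σ_{n ≤ N} (Λ(n)/n)·f(log n)` from `n = 1` against `∫₀^{log N} f`, which
forces `f` to be finite at `t = 0`.  THEOREM B's tilt (CONTINUUM-LIMIT 25.10 (b)) is a sum over the PRIMES of a
range `p ≤ q ≤ X` against `f(t) = 1/(log b + t)²` — singular at `t = 0` when `b = 1` — with the prime sums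
`Σ_{q ≤ x} log q/q = log x + O(1)` known from both sides.  This file is the generic, purely real-variable tool:
a weight sequence `a : ℕ → ℝ` whose partial sums over `(m, n]` are `log n − log m + O(c)` FROM BOTH SIDES, an
antitone `f`, and the conclusion `Σ_{m < n ≤ N} a(n) f(log n) = ∫_{log m}^{log N} f + O(c·f(log m))` from both
sides, by a one-line induction carrying the Abel remainder (as in `IntegerScrewChebyshevAbel`):

* `sum_Icc_mul_le_of_partial_le` / `sum_Icc_mul_ge_of_le_partial` — the discrete Abel inequalities;
* `sum_Icc_log_sub_log_mul_le_integral'` / `integral_le_sum_Icc_log_sub_log_mul'` — the logarithmic Riemann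
  sums of an antitone `f` against `∫ f` over a range;
* **`sum_Icc_mul_comp_log_le_integral`** — `Σ_{m<n≤N} a(n)f(log n) ≤ c·f(log m) + ∫_{log m}^{log N} f`;
* **`integral_sub_le_sum_Icc_mul_comp_log`** — `∫_{log(m+1)}^{log(N+1)} f − c·f(log m) ≤ Σ_{m<n≤N} a(n)f(log n)`;
* `integral_inv_sq_shift'` and the instances **`sum_Icc_mul_inv_sq_le'` / `sum_Icc_mul_inv_sq_ge'`** for
  `f(t) = 1/(s + t)²` (`s + log m > 0`): `Σ_{m<n≤N} a(n)/(s + log n)² ≤ c/(s+log m)² + 1/(s+log m) − 1/(s+log N)`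
  and `≥ 1/(s+log(m+1)) − 1/(s+log(N+1)) − c/(s+log m)²`.

RH-free, elementary (Mathlib only).  Nothing in this file bears on the truth of RH.
References: CONTINUUM-LIMIT §25.10 (rh-explicit A6-PIVOT); M. Suzuki, J. Lond. Math. Soc. (2) 108 (2023)
1448–1487 [Suzuki2023].
-/

noncomputable section

set_option linter.dupNamespace false -- D-0017: `Summit.<S>.<S>.…` is the designed namespace

namespace Summit.RiemannHypothesis.RiemannHypothesis.Theorems.IntegerScrew

open Finset Real

/-! ### Discrete Abel over a range -/

/-- **Range Abel, upper half.**  If `Σ_{m<k≤n} a(k) ≤ log n − log m + c` for `m < n ≤ N` (`c ≥ 0`, `m ≥ 1`) and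
`φ` is non-increasing on `[m, N]`, then for `m ≤ N′ ≤ N`:
`Σ_{m<n≤N′} a(n)φ(n) ≤ c·φ(m) + Σ_{m<n≤N′}(log n − log(n−1))φ(n) + (Σ_{m<k≤N′}a(k) − (log N′ − log m + c))·φ(N′)`
(the last term is `≤ 0` when `φ(N′) ≥ 0`). -/
theorem sum_Icc_mul_le_of_partial_le {a φ : ℕ → ℝ} {m N : ℕ} (hm : 1 ≤ m) {c : ℝ} (hc : 0 ≤ c)
    (hA : ∀ n, m + 1 ≤ n → n ≤ N → ∑ k ∈ Icc (m + 1) n, a k ≤ Real.log n - Real.log m + c)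
    (hφ : ∀ n, m ≤ n → n + 1 ≤ N → φ (n + 1) ≤ φ n) :
    ∀ N', m ≤ N' → N' ≤ N →
      ∑ n ∈ Icc (m + 1) N', a n * φ n ≤
        c * φ m + ∑ n ∈ Icc (m + 1) N', (Real.log n - Real.log (n - 1 : ℕ)) * φ n +
          (∑ k ∈ Icc (m + 1) N', a k - (Real.log N' - Real.log m + c)) * φ N' := by
  intro N' h1 h2
  induction N' with
  | zero => omega
  | succ n ih =>
    by_cases hbase : n + 1 = m
    · subst hbase
      have he : Icc (n + 1 + 1) (n + 1) = ∅ := Finset.Icc_eq_empty_of_lt (by omega)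
      simp only [he, Finset.sum_empty]
      ring_nf
      exact le_rfl
    · have hmn : m ≤ n := by omega
      have ih' := ih hmn (by omega)
      have hmono : φ (n + 1) ≤ φ n := hφ n hmn (by omega)
      have hAn : ∑ k ∈ Icc (m + 1) n, a k ≤ Real.log n - Real.log m + c := by
        rcases Nat.lt_or_ge n (m + 1) with hlt | hge
        · have : n = m := by omega
          subst this
          simp [hc]
        · exact hA n hge (by omega)
      rw [Finset.sum_Icc_succ_top (by omega : m + 1 ≤ n + 1), Finset.sum_Icc_succ_top (by omega : m + 1 ≤ n + 1),
        Finset.sum_Icc_succ_top (by omega : m + 1 ≤ n + 1)]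
      have hcast : ((n + 1 : ℕ) - 1 : ℕ) = n := by omega
      rw [hcast]
      nlinarith [mul_nonneg_of_nonpos_of_nonpos (sub_nonpos.2 (by linarith [hAn] :
        ∑ k ∈ Icc (m + 1) n, a k - Real.log n + Real.log m ≤ c)) (sub_nonpos.2 hmono)]

/-- **Range Abel, lower half.**  If `log n − log m − c ≤ Σ_{m<k≤n} a(k)` for `m < n ≤ N` (`c ≥ 0`, `m ≥ 1`) and
`φ` is non-increasing on `[m, N]`, then for `m ≤ N′ ≤ N`:
`−c·φ(m) + Σ_{m<n≤N′}(log n − log(n−1))φ(n) + (Σ_{m<k≤N′}a(k) − (log N′ − log m − c))·φ(N′) ≤ Σ_{m<n≤N′} a(n)φ(n)`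
(the correction term is `≥ 0` when `φ(N′) ≥ 0`). -/
theorem sum_Icc_mul_ge_of_le_partial {a φ : ℕ → ℝ} {m N : ℕ} (hm : 1 ≤ m) {c : ℝ} (hc : 0 ≤ c)
    (hA : ∀ n, m + 1 ≤ n → n ≤ N → Real.log n - Real.log m - c ≤ ∑ k ∈ Icc (m + 1) n, a k)
    (hφ : ∀ n, m ≤ n → n + 1 ≤ N → φ (n + 1) ≤ φ n) :
    ∀ N', m ≤ N' → N' ≤ N →
      -c * φ m + ∑ n ∈ Icc (m + 1) N', (Real.log n - Real.log (n - 1 : ℕ)) * φ n +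
          (∑ k ∈ Icc (m + 1) N', a k - (Real.log N' - Real.log m - c)) * φ N' ≤
        ∑ n ∈ Icc (m + 1) N', a n * φ n := by
  intro N' h1 h2
  induction N' with
  | zero => omega
  | succ n ih =>
    by_cases hbase : n + 1 = m
    · subst hbase
      have he : Icc (n + 1 + 1) (n + 1) = ∅ := Finset.Icc_eq_empty_of_lt (by omega)
      simp only [he, Finset.sum_empty]
      ring_nf
      exact le_rfl
    · have hmn : m ≤ n := by omega
      have ih' := ih hmn (by omega)
      have hmono : φ (n + 1) ≤ φ n := hφ n hmn (by omega)
      have hAn : Real.log n - Real.log m - c ≤ ∑ k ∈ Icc (m + 1) n, a k := by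
        rcases Nat.lt_or_ge n (m + 1) with hlt | hge
        · have : n = m := by omega
          subst this
          simp [hc]
        · exact hA n hge (by omega)
      rw [Finset.sum_Icc_succ_top (by omega : m + 1 ≤ n + 1), Finset.sum_Icc_succ_top (by omega : m + 1 ≤ n + 1),
        Finset.sum_Icc_succ_top (by omega : m + 1 ≤ n + 1)]
      have hcast : ((n + 1 : ℕ) - 1 : ℕ) = n := by omega
      rw [hcast]
      nlinarith [mul_nonneg (sub_nonneg.2 (by linarith [hAn] :
        -c ≤ ∑ k ∈ Icc (m + 1) n, a k - Real.log n + Real.log m)) (sub_nonneg.2 hmono)]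

/-! ### Logarithmic Riemann sums of an antitone function over a range -/

/-- `Σ_{m<n≤N} (log n − log(n−1))·f(log n) ≤ ∫_{log m}^{log N} f` for `f` antitone on `[log m, log N]` (`m ≥ 1`). -/
theorem sum_Icc_log_sub_log_mul_le_integral' {m : ℕ} (hm : 1 ≤ m) {f : ℝ → ℝ} :
    ∀ N, m ≤ N → AntitoneOn f (Set.Icc (Real.log m) (Real.log N)) →
      ∑ n ∈ Icc (m + 1) N, (Real.log n - Real.log (n - 1 : ℕ)) * f (Real.log n) ≤
        ∫ t in Real.log m..Real.log N, f t := by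
  intro N hN hf
  induction N with
  | zero => omega
  | succ n ih =>
    by_cases hbase : n + 1 = m
    · subst hbase
      have he : Icc (n + 1 + 1) (n + 1) = ∅ := Finset.Icc_eq_empty_of_lt (by omega)
      rw [he, Finset.sum_empty, intervalIntegral.integral_same]
    · have hmn : m ≤ n := by omega
      have hn1 : (1 : ℝ) ≤ n := by exact_mod_cast (show 1 ≤ n by omega)
      have hlogn : Real.log m ≤ Real.log n := Real.log_le_log (by exact_mod_cast hm) (by exact_mod_cast hmn)
      have hlogn1 : Real.log n ≤ Real.log ((n + 1 : ℕ) : ℝ) :=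
        Real.log_le_log (by linarith) (by push_cast; linarith)
      have hf' : AntitoneOn f (Set.Icc (Real.log m) (Real.log n)) :=
        hf.mono (Set.Icc_subset_Icc le_rfl hlogn1)
      have ih' := ih hmn hf'
      rw [Finset.sum_Icc_succ_top (by omega : m + 1 ≤ n + 1)]
      have hcast : ((n + 1 : ℕ) - 1 : ℕ) = n := by omega
      rw [hcast]
      -- the new term against the integral over [log n, log(n+1)]
      have hint1 : IntervalIntegrable f MeasureTheory.volume (Real.log m) (Real.log n) := by
        refine (hf'.mono ?_).intervalIntegrable
        rw [Set.uIcc_of_le hlogn]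
      have hf2 : AntitoneOn f (Set.Icc (Real.log n) (Real.log ((n + 1 : ℕ) : ℝ))) :=
        hf.mono (Set.Icc_subset_Icc hlogn le_rfl)
      have hint2 : IntervalIntegrable f MeasureTheory.volume (Real.log n) (Real.log ((n + 1 : ℕ) : ℝ)) := by
        refine (hf2.mono ?_).intervalIntegrable
        rw [Set.uIcc_of_le hlogn1]
      have hstep : (Real.log ((n + 1 : ℕ) : ℝ) - Real.log n) * f (Real.log ((n + 1 : ℕ) : ℝ)) ≤
          ∫ t in Real.log n..Real.log ((n + 1 : ℕ) : ℝ), f t := by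
        calc (Real.log ((n + 1 : ℕ) : ℝ) - Real.log n) * f (Real.log ((n + 1 : ℕ) : ℝ))
            = ∫ _ in Real.log n..Real.log ((n + 1 : ℕ) : ℝ), f (Real.log ((n + 1 : ℕ) : ℝ)) := by
              rw [intervalIntegral.integral_const, smul_eq_mul]
          _ ≤ ∫ t in Real.log n..Real.log ((n + 1 : ℕ) : ℝ), f t := by
              refine intervalIntegral.integral_mono_on hlogn1 intervalIntegrable_const hint2 ?_
              intro t ht
              exact hf2 ⟨ht.1, ht.2⟩ ⟨hlogn1, le_rfl⟩ ht.2
      rw [← intervalIntegral.integral_add_adjacent_intervals hint1 hint2]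
      linarith

/-- `∫_{log(m+1)}^{log(N+1)} f ≤ Σ_{m<n≤N} (log n − log(n−1))·f(log n)` for `f ≥ 0` antitone on
`[log m, log(N+1)]` (`m ≥ 1`; uses `log(n+1) − log n ≤ log n − log(n−1)`). -/
theorem integral_le_sum_Icc_log_sub_log_mul' {m : ℕ} (hm : 1 ≤ m) {f : ℝ → ℝ} :
    ∀ N, m ≤ N → AntitoneOn f (Set.Icc (Real.log m) (Real.log ((N + 1 : ℕ) : ℝ))) →
      (∀ t ∈ Set.Icc (Real.log m) (Real.log ((N + 1 : ℕ) : ℝ)), 0 ≤ f t) →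
      ∫ t in Real.log ((m + 1 : ℕ) : ℝ)..Real.log ((N + 1 : ℕ) : ℝ), f t ≤
        ∑ n ∈ Icc (m + 1) N, (Real.log n - Real.log (n - 1 : ℕ)) * f (Real.log n) := by
  intro N hN hf hf0
  induction N with
  | zero => omega
  | succ n ih =>
    by_cases hbase : n + 1 = m
    · subst hbase
      have he : Icc (n + 1 + 1) (n + 1) = ∅ := Finset.Icc_eq_empty_of_lt (by omega)
      rw [he, Finset.sum_empty, intervalIntegral.integral_same]
    · have hmn : m ≤ n := by omega
      have hn1 : (1 : ℝ) ≤ n := by exact_mod_cast (show 1 ≤ n by omega)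
      have hlogm : Real.log m ≤ Real.log ((n + 1 : ℕ) : ℝ) :=
        Real.log_le_log (by exact_mod_cast hm) (by exact_mod_cast (show m ≤ n + 1 by omega))
      have hlog12 : Real.log ((n + 1 : ℕ) : ℝ) ≤ Real.log ((n + 1 + 1 : ℕ) : ℝ) :=
        Real.log_le_log (by positivity) (by push_cast; linarith)
      have hf' : AntitoneOn f (Set.Icc (Real.log m) (Real.log ((n + 1 : ℕ) : ℝ))) :=
        hf.mono (Set.Icc_subset_Icc le_rfl hlog12)
      have ih' := ih hmn hf' (fun t ht => hf0 t ⟨ht.1, ht.2.trans hlog12⟩)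
      rw [Finset.sum_Icc_succ_top (by omega : m + 1 ≤ n + 1)]
      have hcast : ((n + 1 : ℕ) - 1 : ℕ) = n := by omega
      rw [hcast]
      have hlogm1 : Real.log ((m + 1 : ℕ) : ℝ) ≤ Real.log ((n + 1 : ℕ) : ℝ) :=
        Real.log_le_log (by positivity) (by exact_mod_cast (show m + 1 ≤ n + 1 by omega))
      have hlogm0 : Real.log m ≤ Real.log ((m + 1 : ℕ) : ℝ) :=
        Real.log_le_log (by exact_mod_cast hm) (by push_cast; linarith)
      have hint1 : IntervalIntegrable f MeasureTheory.volume (Real.log ((m + 1 : ℕ) : ℝ))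
          (Real.log ((n + 1 : ℕ) : ℝ)) := by
        refine (hf'.mono ?_).intervalIntegrable
        rw [Set.uIcc_of_le hlogm1]
        exact Set.Icc_subset_Icc hlogm0 le_rfl
      have hf2 : AntitoneOn f (Set.Icc (Real.log ((n + 1 : ℕ) : ℝ)) (Real.log ((n + 1 + 1 : ℕ) : ℝ))) :=
        hf.mono (Set.Icc_subset_Icc hlogm le_rfl)
      have hint2 : IntervalIntegrable f MeasureTheory.volume (Real.log ((n + 1 : ℕ) : ℝ))
          (Real.log ((n + 1 + 1 : ℕ) : ℝ)) := by
        refine (hf2.mono ?_).intervalIntegrable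
        rw [Set.uIcc_of_le hlog12]
      -- concavity of log: log(n+2) − log(n+1) ≤ log(n+1) − log n
      have hconc : Real.log ((n + 1 + 1 : ℕ) : ℝ) - Real.log ((n + 1 : ℕ) : ℝ) ≤
          Real.log ((n + 1 : ℕ) : ℝ) - Real.log n := by
        have hn0 : (0 : ℝ) < n := by linarith
        have h1 : Real.log ((n + 1 + 1 : ℕ) : ℝ) + Real.log n ≤
            Real.log ((n + 1 : ℕ) : ℝ) + Real.log ((n + 1 : ℕ) : ℝ) := by
          rw [← Real.log_mul (by positivity) hn0.ne', ← Real.log_mul (by positivity) (by positivity)]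
          refine Real.log_le_log (by positivity) ?_
          push_cast
          nlinarith
        linarith
      have hfn1 : 0 ≤ f (Real.log ((n + 1 : ℕ) : ℝ)) := hf0 _ ⟨hlogm, hlog12⟩
      have hstep : ∫ t in Real.log ((n + 1 : ℕ) : ℝ)..Real.log ((n + 1 + 1 : ℕ) : ℝ), f t ≤
          (Real.log ((n + 1 : ℕ) : ℝ) - Real.log n) * f (Real.log ((n + 1 : ℕ) : ℝ)) := by
        calc ∫ t in Real.log ((n + 1 : ℕ) : ℝ)..Real.log ((n + 1 + 1 : ℕ) : ℝ), f t
            ≤ ∫ _ in Real.log ((n + 1 : ℕ) : ℝ)..Real.log ((n + 1 + 1 : ℕ) : ℝ), f (Real.log ((n + 1 : ℕ) : ℝ)) := by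
              refine intervalIntegral.integral_mono_on hlog12 hint2 intervalIntegrable_const ?_
              intro t ht
              exact hf2 ⟨le_rfl, hlog12⟩ ⟨ht.1, ht.2⟩ ht.1
          _ = (Real.log ((n + 1 + 1 : ℕ) : ℝ) - Real.log ((n + 1 : ℕ) : ℝ)) * f (Real.log ((n + 1 : ℕ) : ℝ)) := by
              rw [intervalIntegral.integral_const, smul_eq_mul]
          _ ≤ (Real.log ((n + 1 : ℕ) : ℝ) - Real.log n) * f (Real.log ((n + 1 : ℕ) : ℝ)) :=
              mul_le_mul_of_nonneg_right hconc hfn1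
      rw [← intervalIntegral.integral_add_adjacent_intervals hint1 hint2]
      linarith

/-! ### Both halves against the integral -/

/-- **Range Abel against the integral, upper half.**  `m ≥ 1`, `m ≤ N`, `c ≥ 0`,
`Σ_{m<k≤n} a(k) ≤ log n − log m + c` (`m < n ≤ N`), `f` antitone on `[log m, log N]`, `f(log N) ≥ 0` ⊢
`Σ_{m<n≤N} a(n)f(log n) ≤ c·f(log m) + ∫_{log m}^{log N} f`. -/
theorem sum_Icc_mul_comp_log_le_integral {a : ℕ → ℝ} {m N : ℕ} (hm : 1 ≤ m) (hmN : m ≤ N) {c : ℝ} (hc : 0 ≤ c)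
    (hA : ∀ n, m + 1 ≤ n → n ≤ N → ∑ k ∈ Icc (m + 1) n, a k ≤ Real.log n - Real.log m + c)
    {f : ℝ → ℝ} (hf : AntitoneOn f (Set.Icc (Real.log m) (Real.log N))) (hfN : 0 ≤ f (Real.log N)) :
    ∑ n ∈ Icc (m + 1) N, a n * f (Real.log n) ≤ c * f (Real.log m) + ∫ t in Real.log m..Real.log N, f t := by
  have hφ : ∀ n, m ≤ n → n + 1 ≤ N → f (Real.log ((n + 1 : ℕ) : ℝ)) ≤ f (Real.log n) := by
    intro n hn hn1
    have h0 : (1 : ℝ) ≤ n := by exact_mod_cast (le_trans hm hn)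
    have hl1 : Real.log m ≤ Real.log n := Real.log_le_log (by exact_mod_cast hm) (by exact_mod_cast hn)
    have hl2 : Real.log n ≤ Real.log ((n + 1 : ℕ) : ℝ) := Real.log_le_log (by linarith) (by push_cast; linarith)
    have hl3 : Real.log ((n + 1 : ℕ) : ℝ) ≤ Real.log N :=
      Real.log_le_log (by positivity) (by exact_mod_cast hn1)
    exact hf ⟨hl1, hl2.trans hl3⟩ ⟨hl1.trans hl2, hl3⟩ hl2
  have h1 := sum_Icc_mul_le_of_partial_le (φ := fun n => f (Real.log n)) hm hc hA hφ N hmN le_rfl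
  have h2 := sum_Icc_log_sub_log_mul_le_integral' hm N hmN hf
  have hAN : ∑ k ∈ Icc (m + 1) N, a k - (Real.log N - Real.log m + c) ≤ 0 := by
    rcases Nat.lt_or_ge N (m + 1) with hlt | hge
    · have : N = m := by omega
      subst this
      simp [hc]
    · linarith [hA N hge le_rfl]
  have h3 : (∑ k ∈ Icc (m + 1) N, a k - (Real.log N - Real.log m + c)) * f (Real.log N) ≤ 0 :=
    mul_nonpos_of_nonpos_of_nonneg hAN hfN
  linarith

/-- **Range Abel against the integral, lower half.**  `m ≥ 1`, `m ≤ N`, `c ≥ 0`,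
`log n − log m − c ≤ Σ_{m<k≤n} a(k)` (`m < n ≤ N`), `f ≥ 0` antitone on `[log m, log(N+1)]` ⊢
`∫_{log(m+1)}^{log(N+1)} f − c·f(log m) ≤ Σ_{m<n≤N} a(n)f(log n)`. -/
theorem integral_sub_le_sum_Icc_mul_comp_log {a : ℕ → ℝ} {m N : ℕ} (hm : 1 ≤ m) (hmN : m ≤ N) {c : ℝ}
    (hc : 0 ≤ c) (hA : ∀ n, m + 1 ≤ n → n ≤ N → Real.log n - Real.log m - c ≤ ∑ k ∈ Icc (m + 1) n, a k)
    {f : ℝ → ℝ} (hf : AntitoneOn f (Set.Icc (Real.log m) (Real.log ((N + 1 : ℕ) : ℝ))))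
    (hf0 : ∀ t ∈ Set.Icc (Real.log m) (Real.log ((N + 1 : ℕ) : ℝ)), 0 ≤ f t) :
    (∫ t in Real.log ((m + 1 : ℕ) : ℝ)..Real.log ((N + 1 : ℕ) : ℝ), f t) - c * f (Real.log m) ≤
      ∑ n ∈ Icc (m + 1) N, a n * f (Real.log n) := by
  have hlogN : Real.log N ≤ Real.log ((N + 1 : ℕ) : ℝ) := by
    have : (1 : ℝ) ≤ N := by exact_mod_cast (le_trans hm hmN)
    exact Real.log_le_log (by linarith) (by push_cast; linarith)
  have hφ : ∀ n, m ≤ n → n + 1 ≤ N → f (Real.log ((n + 1 : ℕ) : ℝ)) ≤ f (Real.log n) := by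
    intro n hn hn1
    have h0 : (1 : ℝ) ≤ n := by exact_mod_cast (le_trans hm hn)
    have hl1 : Real.log m ≤ Real.log n := Real.log_le_log (by exact_mod_cast hm) (by exact_mod_cast hn)
    have hl2 : Real.log n ≤ Real.log ((n + 1 : ℕ) : ℝ) := Real.log_le_log (by linarith) (by push_cast; linarith)
    have hl3 : Real.log ((n + 1 : ℕ) : ℝ) ≤ Real.log ((N + 1 : ℕ) : ℝ) :=
      (Real.log_le_log (by positivity) (by exact_mod_cast hn1)).trans hlogN
    exact hf ⟨hl1, hl2.trans hl3⟩ ⟨hl1.trans hl2, hl3⟩ hl2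
  have h1 := sum_Icc_mul_ge_of_le_partial (φ := fun n => f (Real.log n)) hm hc hA hφ N hmN le_rfl
  have h2 := integral_le_sum_Icc_log_sub_log_mul' hm N hmN hf hf0
  have hAN : 0 ≤ ∑ k ∈ Icc (m + 1) N, a k - (Real.log N - Real.log m - c) := by
    rcases Nat.lt_or_ge N (m + 1) with hlt | hge
    · have : N = m := by omega
      subst this
      simp [hc]
    · linarith [hA N hge le_rfl]
  have hfN : 0 ≤ f (Real.log N) :=
    hf0 _ ⟨Real.log_le_log (by exact_mod_cast hm) (by exact_mod_cast hmN), hlogN⟩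
  have h3 : 0 ≤ (∑ k ∈ Icc (m + 1) N, a k - (Real.log N - Real.log m - c)) * f (Real.log N) :=
    mul_nonneg hAN hfN
  linarith

/-! ### The instance `f(t) = 1/(s + t)²` -/

/-- `∫_{u}^{v} dt/(s + t)² = 1/(s + u) − 1/(s + v)` for `s + u > 0`, `u ≤ v`. -/
theorem integral_inv_sq_shift' {s u v : ℝ} (hsu : 0 < s + u) (huv : u ≤ v) :
    ∫ t in u..v, 1 / (s + t) ^ 2 = 1 / (s + u) - 1 / (s + v) := by
  have hderiv : ∀ t ∈ Set.uIcc u v, HasDerivAt (fun t => -1 / (s + t)) (1 / (s + t) ^ 2) t := by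
    intro t ht
    rw [Set.uIcc_of_le huv] at ht
    have hst : s + t ≠ 0 := by linarith [ht.1]
    have h1 : HasDerivAt (fun y : ℝ => s + y) 1 t := (hasDerivAt_id t).const_add s
    have h3 : HasDerivAt (fun y : ℝ => -1 * (s + y)⁻¹) (-1 * (-1 / (s + t) ^ 2)) t :=
      (h1.inv hst).const_mul (-1)
    have hfun : (fun y : ℝ => -1 / (s + y)) = fun y => -1 * (s + y)⁻¹ := by
      funext y; rw [div_eq_mul_inv]
    rw [hfun]
    convert h3 using 1
    field_simp
  have hcont : ContinuousOn (fun t => 1 / (s + t) ^ 2) (Set.uIcc u v) := by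
    refine ContinuousOn.div continuousOn_const (by fun_prop) ?_
    intro t ht
    rw [Set.uIcc_of_le huv] at ht
    have : 0 < s + t := by linarith [ht.1]
    positivity
  rw [intervalIntegral.integral_eq_sub_of_hasDerivAt hderiv (hcont.intervalIntegrable)]
  have h0 : s + u ≠ 0 := by linarith
  have h1 : s + v ≠ 0 := by linarith
  field_simp
  ring

/-- `t ↦ 1/(s+t)²` is antitone on `[u, ∞)` when `s + u > 0`. -/
theorem antitoneOn_inv_sq_shift {s u : ℝ} (hsu : 0 < s + u) : AntitoneOn (fun t => 1 / (s + t) ^ 2) (Set.Ici u) := by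
  intro x hx y hy hxy
  have hx' : 0 < s + x := by linarith [Set.mem_Ici.1 hx]
  have hy' : 0 < s + y := by linarith [Set.mem_Ici.1 hy]
  exact one_div_le_one_div_of_le (by positivity) (by nlinarith)

/-- **Upper instance**: under the upper partial-sum hypothesis, for `s + log m > 0`, `1 ≤ m ≤ N`:
`Σ_{m<n≤N} a(n)/(s + log n)² ≤ c/(s + log m)² + (1/(s + log m) − 1/(s + log N))`. -/
theorem sum_Icc_mul_inv_sq_le' {a : ℕ → ℝ} {m N : ℕ} (hm : 1 ≤ m) (hmN : m ≤ N) {c : ℝ} (hc : 0 ≤ c)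
    (hA : ∀ n, m + 1 ≤ n → n ≤ N → ∑ k ∈ Icc (m + 1) n, a k ≤ Real.log n - Real.log m + c)
    {s : ℝ} (hs : 0 < s + Real.log m) :
    ∑ n ∈ Icc (m + 1) N, a n * (1 / (s + Real.log n) ^ 2) ≤
      c * (1 / (s + Real.log m) ^ 2) + (1 / (s + Real.log m) - 1 / (s + Real.log N)) := by
  have hlog : Real.log m ≤ Real.log N := Real.log_le_log (by exact_mod_cast hm) (by exact_mod_cast hmN)
  have hf : AntitoneOn (fun t => 1 / (s + t) ^ 2) (Set.Icc (Real.log m) (Real.log N)) :=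
    (antitoneOn_inv_sq_shift hs).mono (fun t ht => Set.mem_Ici.2 ht.1)
  have h := sum_Icc_mul_comp_log_le_integral hm hmN hc hA hf (by positivity)
  rw [integral_inv_sq_shift' hs hlog] at h
  exact h

/-- **Lower instance**: under the lower partial-sum hypothesis, for `s + log m > 0`, `1 ≤ m ≤ N`:
`1/(s + log(m+1)) − 1/(s + log(N+1)) − c/(s + log m)² ≤ Σ_{m<n≤N} a(n)/(s + log n)²`. -/
theorem sum_Icc_mul_inv_sq_ge' {a : ℕ → ℝ} {m N : ℕ} (hm : 1 ≤ m) (hmN : m ≤ N) {c : ℝ} (hc : 0 ≤ c)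
    (hA : ∀ n, m + 1 ≤ n → n ≤ N → Real.log n - Real.log m - c ≤ ∑ k ∈ Icc (m + 1) n, a k)
    {s : ℝ} (hs : 0 < s + Real.log m) :
    1 / (s + Real.log ((m + 1 : ℕ) : ℝ)) - 1 / (s + Real.log ((N + 1 : ℕ) : ℝ)) - c * (1 / (s + Real.log m) ^ 2) ≤
      ∑ n ∈ Icc (m + 1) N, a n * (1 / (s + Real.log n) ^ 2) := by
  have hm0 : (1 : ℝ) ≤ m := by exact_mod_cast hm
  have hlog0 : Real.log m ≤ Real.log ((m + 1 : ℕ) : ℝ) := Real.log_le_log (by linarith) (by push_cast; linarith)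
  have hlog1 : Real.log ((m + 1 : ℕ) : ℝ) ≤ Real.log ((N + 1 : ℕ) : ℝ) :=
    Real.log_le_log (by positivity) (by exact_mod_cast (show m + 1 ≤ N + 1 by omega))
  have hf : AntitoneOn (fun t => 1 / (s + t) ^ 2) (Set.Icc (Real.log m) (Real.log ((N + 1 : ℕ) : ℝ))) :=
    (antitoneOn_inv_sq_shift hs).mono (fun t ht => Set.mem_Ici.2 ht.1)
  have hf0 : ∀ t ∈ Set.Icc (Real.log m) (Real.log ((N + 1 : ℕ) : ℝ)), 0 ≤ (fun t => 1 / (s + t) ^ 2) t :=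
    fun t _ => by positivity
  have h := integral_sub_le_sum_Icc_mul_comp_log hm hmN hc hA hf hf0
  have hs1 : 0 < s + Real.log ((m + 1 : ℕ) : ℝ) := by linarith
  rw [integral_inv_sq_shift' hs1 hlog1] at h
  simpa using h

/-- **Upper instance, simple form**: drop the negative term of `sum_Icc_mul_inv_sq_le'`:
`Σ_{m<n≤N} a(n)/(s + log n)² ≤ c/(s + log m)² + 1/(s + log m)`. -/
theorem sum_Icc_mul_inv_sq_le'_simple {a : ℕ → ℝ} {m N : ℕ} (hm : 1 ≤ m) (hmN : m ≤ N) {c : ℝ} (hc : 0 ≤ c)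
    (hA : ∀ n, m + 1 ≤ n → n ≤ N → ∑ k ∈ Icc (m + 1) n, a k ≤ Real.log n - Real.log m + c)
    {s : ℝ} (hs : 0 < s + Real.log m) :
    ∑ n ∈ Icc (m + 1) N, a n * (1 / (s + Real.log n) ^ 2) ≤
      c * (1 / (s + Real.log m) ^ 2) + 1 / (s + Real.log m) := by
  have h := sum_Icc_mul_inv_sq_le' hm hmN hc hA hs
  have hlog : Real.log m ≤ Real.log N := Real.log_le_log (by exact_mod_cast hm) (by exact_mod_cast hmN)
  have h1 : 0 ≤ 1 / (s + Real.log N) := by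
    have : 0 < s + Real.log N := by linarith
    positivity
  linarith

end Summit.RiemannHypothesis.RiemannHypothesis.Theorems.IntegerScrew

end
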